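import Summits.MatrixMultiplication.OmegaCensus.StrongUSPOmegaBound
import Summits.MatrixMultiplication.OmegaCensus.StrongUSPCheck
import Summits.MatrixMultiplication.OmegaCensus.StrongUSPHallCert
import Summits.MatrixMultiplication.OmegaCensus.StrongUSPMaskCertAL
import Summits.MatrixMultiplication.OmegaCensus.StrongUSPMaskCertAJX
import Summits.MatrixMultiplication.OmegaCensus.StrongUSPCertPacked358

/-!
# ω-census, family (b1-S): kernel ω-rows from the certified (8,5) and (14,6) strong USPs

HONEST FRAMING (pub-omega census; verbatim): lottery ticket; floor = certified bounds/negative ranges.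
Census bookkeeping, not progress on `ω` (the tree proves `ω < 2.373`; these rows read 2.73–2.78).

The STPP-track's strong-USP objects certified in the kernel — the census (8,5) class representative and
Anderson–Le's printed (8,5) (both by the exhaustive search of `StrongUSPCheck.lean` AND by Hall-deletion certificates,
`StrongUSPHallCert.lean`) and Anderson–Le's printed (14,6) (Hall-deletion certificate, 198 steps) — pushed through
CKSU 2005 Cor. 3.6 / 16 (= Anderson–Ji–Xu 2020 Lemma 1) in its tree form `omega_le_div_of_isStrongUSP`
(lit seat, `StrongUSPOmegaBound.lean`): `m^{3b·sk} ≤ (s!)^{3b} (m−1)^{a·sk} ⇒ ω ≤ a/b`.  Values (exact, certified optimal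
`m` by the seats' engines): (8,5) at `m = 13`: `3(40 log 13 − log 8!)/(40 log 12) = 2.7765642042…`; (14,6) at `m = 11`:
`3(84 log 11 − log 14!)/(84 log 10) = 2.7334491857…` (= Anderson–Ji–Xu Table 1, k = 5 / k = 6 rows '2.777' / '2.733').
The decimals below are the 4-dp round-ups; each integer certificate is tight (the next decimal down fails).

References: Cohn–Kleinberg–Szegedy–Umans, FOCS 2005 (arXiv:math/0511460) Cor. 16 [3.6]; Anderson–Ji–Xu, SAT 2020 /
arXiv:2301.00074 Lemma 1, Table 1, Table 3; Anderson–Le, COCOON 2023 / arXiv:2307.06463, Appendix p. 20.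
-/

noncomputable section

open Literature.Computability.AlgebraicComplexity

namespace Summit.MatrixMultiplication.OmegaCensus

/-- Census row (b1-S) **(8,5), census representative**: the strong USP `{11111, 11123, 11233, 23113, 23122, 23312,
33221, 33232}` (kernel: `isStrongUSP_k5_s8_rep00`; a maximum strong USP of width 5, `s_max^SUSP(5) = 8` ×2 in the
census) gives, through CKSU Cor. 16 at `m = 13`, `ω ≤ 2.7766` — integer certificate
`13^(3·5000·40) ≤ (8!)^(3·5000) · 12^(13883·40)` (`13883/5000 = 2.7766`; exact value `2.7765642042…`; `2.7765` fails).
[cite: CohnKleinbergSzegedyUmans2005, Cor. 16 (§3, p. 6)] [cite: AndersonJiXu2020, Lemma 1 and Table 1 (k = 5 row)] -/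
theorem omega_le_of_strongUSP_8_5_census : omega ℂ ≤ 2.7766 := by
  have h := omega_le_div_of_isStrongUSP isStrongUSP_k5_s8_rep00 (by norm_num) (by norm_num)
    (m := 13) (by norm_num) (a := 13883) (b := 5000) (by norm_num) (by decide +kernel)
  have e : ((13883 : ℕ) : ℝ) / ((5000 : ℕ) : ℝ) = 2.7766 := by norm_num
  rwa [e] at h

/-- Census row (b1-S) **(8,5), printed object**: Anderson–Le's "Simplifiable (8,5)-SUSP" `{11111, 12231, 12312, 13222,
31132, 32212, 32223, 33122}` (kernel: `isStrongUSP_AndersonLe_8_5`) gives `ω ≤ 2.7766` through CKSU Cor. 16 at `m = 13`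
(same certificate as the census representative: the bound depends on `(s,k) = (8,5)` only).
[cite: AndersonLe2023, Appendix (p. 20), "Simplifiable (8,5)-SUSP"] [cite: CohnKleinbergSzegedyUmans2005, Cor. 16 (§3, p. 6)] -/
theorem omega_le_of_strongUSP_AndersonLe_8_5 : omega ℂ ≤ 2.7766 := by
  have h := omega_le_div_of_isStrongUSP isStrongUSP_AndersonLe_8_5 (by norm_num) (by norm_num)
    (m := 13) (by norm_num) (a := 13883) (b := 5000) (by norm_num) (by decide +kernel)
  have e : ((13883 : ℕ) : ℝ) / ((5000 : ℕ) : ℝ) = 2.7766 := by norm_num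
  rwa [e] at h

/-- Census row (b1-S) **(14,6), printed object**: Anderson–Le's "Simplifiable (14,6)-SUSP" (14 rows of width 6, the
Anderson–Ji–Xu Table 1 record for `k = 6`; kernel: `isStrongUSP_AndersonLe_14_6`, Hall-deletion certificate of 198 steps)
gives, through CKSU Cor. 16 at `m = 11`, **`ω ≤ 2.7335`** — integer certificate
`11^(3·2000·84) ≤ (14!)^(3·2000) · 10^(5467·84)` (`5467/2000 = 2.7335`; exact value `2.7334491857…`; `2.7334` fails).
The best kernel ω-value of the STPP/USP track from a FINITE printed strong USP.
[cite: AndersonLe2023, Appendix (p. 20), "Simplifiable (14,6)-SUSP"] [cite: AndersonJiXu2020, Lemma 1 and Table 1 (k = 6 row)]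
[cite: CohnKleinbergSzegedyUmans2005, Cor. 16 (§3, p. 6)] -/
theorem omega_le_of_strongUSP_AndersonLe_14_6 : omega ℂ ≤ 2.7335 := by
  have h := omega_le_div_of_isStrongUSP isStrongUSP_AndersonLe_14_6 (by norm_num) (by norm_num)
    (m := 11) (by norm_num) (a := 5467) (b := 2000) (by norm_num) (by decide +kernel)
  have e : ((5467 : ℕ) : ℝ) / ((2000 : ℕ) : ℝ) = 2.7335 := by norm_num
  rwa [e] at h

/-- Census row (b1-S) **(52,9), printed object**: Anderson–Le's "Simplifiable (52,9)-SUSP" (arXiv:2307.06463, Appendix A;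
kernel: `isStrongUSP_AndersonLe_52_9`, 99-block bitmask closed-set certificate, `StrongUSPMaskCertAL.lean`) gives, through
CKSU Cor. 16 at `m = 10`, **`ω ≤ 2.6877`** — integer certificate `10^(3·317·468) ≤ (52!)^(3·317) · 9^(852·468)`
(`852/317 = 2.68769…`; exact value `3(468 log 10 − log 52!)/(468 log 9) = 2.6876825822…`; `851/317` fails).
[cite: AndersonLe2023, Appendix A, "Simplifiable (52,9)-SUSP"] [cite: CohnKleinbergSzegedyUmans2005, Cor. 16 (§3, p. 6)] -/
theorem omega_le_of_strongUSP_AndersonLe_52_9 : omega ℂ ≤ 2.6877 := by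
  have h := omega_le_div_of_isStrongUSP isStrongUSP_AndersonLe_52_9 (by norm_num) (by norm_num)
    (m := 10) (by norm_num) (a := 852) (b := 317) (by norm_num) (by decide +kernel)
  have e : ((852 : ℕ) : ℝ) / ((317 : ℕ) : ℝ) ≤ 2.6877 := by norm_num
  exact h.trans e

/-- Census row (b1-S) **(78,10), printed object**: Anderson–Le's "Simplifiable (78,10)-SUSP" (arXiv:2307.06463, Appendix A —
the largest object printed there; kernel: `isStrongUSP_AndersonLe_78_10`, 145-block certificate) gives, through CKSU Cor. 16 at
`m = 9`, **`ω ≤ 2.68`** — integer certificate `9^(3·25·780) ≤ (78!)^(3·25) · 8^(67·780)` (`67/25 = 2.68`; exact value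
`3(780 log 9 − log 78!)/(780 log 8) = 2.6799235266…`; `2.6799` fails).  The best kernel ω-value of the STPP/USP track from a
single FINITE printed strong USP (Anderson–Le's `2.505` is the value of the infinite family built from it, a LIMIT).
[cite: AndersonLe2023, Appendix A, "Simplifiable (78,10)-SUSP"] [cite: CohnKleinbergSzegedyUmans2005, Cor. 16 (§3, p. 6)] -/
theorem omega_le_of_strongUSP_AndersonLe_78_10 : omega ℂ ≤ 2.68 := by
  have h := omega_le_div_of_isStrongUSP isStrongUSP_AndersonLe_78_10 (by norm_num) (by norm_num)
    (m := 9) (by norm_num) (a := 67) (b := 25) (by norm_num) (by decide +kernel)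
  have e : ((67 : ℕ) : ℝ) / ((25 : ℕ) : ℝ) = 2.68 := by norm_num
  rwa [e] at h


/-- Census row (b1-S) **AJX (21,7)**: Anderson–Ji–Xu's own (21,7) strong USP (repository data set, puzzle #1; kernel:
`isStrongUSP_AJX_21_7`, `StrongUSPMaskCertAJX.lean`) gives, through CKSU Cor. 16 at `m = 11`, `ω ≤ 2.7220` — AJX Table 1's
printed `2.722` for `k = 7` AS PRINTED, now from a kernel-certified object; integer certificate
`11^(3·223·147) ≤ (21!)^(3·223) · 10^(607·147)` (`607/223 ≤ 2.7220`; exact value `2.7219669552…`; `606/223` fails).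
[cite: AndersonJiXu2020, Table 1 (k = 7 row) and Lemma 1] [cite: CohnKleinbergSzegedyUmans2005, Cor. 16 (§3, p. 6)] -/
theorem omega_le_of_strongUSP_AJX_21_7 : omega ℂ ≤ 2.7220 := by
  have h := omega_le_div_of_isStrongUSP isStrongUSP_AJX_21_7 (by norm_num) (by norm_num)
    (m := 11) (by norm_num) (a := 607) (b := 223) (by norm_num) (by decide +kernel)
  have e : ((607 : ℕ) : ℝ) / ((223 : ℕ) : ℝ) ≤ 2.7220 := by norm_num
  exact h.trans e

/-- Census row (b1-S) **AJX (30,8)**: Anderson–Ji–Xu's own (30,8) strong USP (data set, puzzle #1; kernel: `isStrongUSP_AJX_30_8`)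
gives, through CKSU Cor. 16 at `m = 11`, `ω ≤ 2.7189` (AJX Table 1, k = 8: `2.719`); integer certificate
`11^(3·217·240) ≤ (30!)^(3·217) · 10^(590·240)` (`590/217 ≤ 2.7189`; exact `2.7188823045…`; `589/217` fails).
[cite: AndersonJiXu2020, Table 1 (k = 8 row) and Lemma 1] [cite: CohnKleinbergSzegedyUmans2005, Cor. 16 (§3, p. 6)] -/
theorem omega_le_of_strongUSP_AJX_30_8 : omega ℂ ≤ 2.7189 := by
  have h := omega_le_div_of_isStrongUSP isStrongUSP_AJX_30_8 (by norm_num) (by norm_num)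
    (m := 11) (by norm_num) (a := 590) (b := 217) (by norm_num) (by decide +kernel)
  have e : ((590 : ℕ) : ℝ) / ((217 : ℕ) : ℝ) ≤ 2.7189 := by norm_num
  exact h.trans e

/-- Census row (b1-S) **AJX (42,9)**: Anderson–Ji–Xu's own (42,9) strong USP (data set, puzzle #1; kernel: `isStrongUSP_AJX_42_9`)
gives, through CKSU Cor. 16 at `m = 11`, `ω ≤ 2.7183` (AJX Table 1, k = 9: `2.718`); integer certificate
`11^(3·252·378) ≤ (42!)^(3·252) · 10^(685·378)` (`685/252 ≤ 2.7183`; exact `2.7182441014…`; `684/252` fails).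
[cite: AndersonJiXu2020, Table 1 (k = 9 row) and Lemma 1] [cite: CohnKleinbergSzegedyUmans2005, Cor. 16 (§3, p. 6)] -/
theorem omega_le_of_strongUSP_AJX_42_9 : omega ℂ ≤ 2.7183 := by
  have h := omega_le_div_of_isStrongUSP isStrongUSP_AJX_42_9 (by norm_num) (by norm_num)
    (m := 11) (by norm_num) (a := 685) (b := 252) (by norm_num) (by decide +kernel)
  have e : ((685 : ℕ) : ℝ) / ((252 : ℕ) : ℝ) ≤ 2.7183 := by norm_num
  exact h.trans e

/-- Census row (b1-S) **(23,7), printed object, via `log s!`**: Anderson–Le's "Simplifiable (23,7)-SUSP" (arXiv:2307.06463,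
Appendix A; kernel: `isStrongUSP_AndersonLe_23_7`, bit-packed pigeonhole certificate, `StrongUSPCertPacked.lean`) gives, through
CKSU Cor. 16 at `m = 10`, `ω ≤ 2.7063` — integer certificate `10^(3·143·161) ≤ (23!)^(3·143) · 9^(387·161)` (`387/143 = 2.70629…`;
exact value `3(161 log 10 − log 23!)/(161 log 9) = 2.7062050313…`; `386/143` fails; `m = 10` is optimal, `m = 11` gives `2.70655…`).
The same object through Anderson–Le's Theorem 2 gives `2.505` (`SimplifiableSUSPOmegaBound.lean`); this row only completes the `s!` column.
[cite: AndersonLe2023, Appendix A, "Simplifiable (23,7)-SUSP"] [cite: CohnKleinbergSzegedyUmans2005, Cor. 16 (§3, p. 6)] -/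
theorem omega_le_of_strongUSP_AndersonLe_23_7 : omega ℂ ≤ 2.7063 := by
  have h := omega_le_div_of_isStrongUSP isStrongUSP_AndersonLe_23_7 (by norm_num) (by norm_num)
    (m := 10) (by norm_num) (a := 387) (b := 143) (by norm_num) (by decide +kernel)
  have e : ((387 : ℕ) : ℝ) / ((143 : ℕ) : ℝ) ≤ 2.7063 := by norm_num
  exact h.trans e

/-- Census row (b1-S) **(35,8), printed object, via `log s!`**: Anderson–Le's "Simplifiable (35,8)-SUSP" (arXiv:2307.06463,
Appendix A; kernel: `isStrongUSP_AndersonLe_35_8`, byte-packed certificate, `StrongUSPCertPacked358.lean`) gives, through CKSU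
Cor. 16 at `m = 10`, `ω ≤ 2.6946` — integer certificate `10^(3·203·280) ≤ (35!)^(3·203) · 9^(547·280)` (`547/203 = 2.69458…`;
exact value `3(280 log 10 − log 35!)/(280 log 9) = 2.6945729762…`; `546/203` fails; `m = 10` optimal, `m = 11` gives `2.69545…`).
Through Anderson–Le's Theorem 2 the same object gives `2.5115`.
[cite: AndersonLe2023, Appendix A, "Simplifiable (35,8)-SUSP"] [cite: CohnKleinbergSzegedyUmans2005, Cor. 16 (§3, p. 6)] -/
theorem omega_le_of_strongUSP_AndersonLe_35_8 : omega ℂ ≤ 2.6946 := by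
  have h := omega_le_div_of_isStrongUSP isStrongUSP_AndersonLe_35_8 (by norm_num) (by norm_num)
    (m := 10) (by norm_num) (a := 547) (b := 203) (by norm_num) (by decide +kernel)
  have e : ((547 : ℕ) : ℝ) / ((203 : ℕ) : ℝ) ≤ 2.6946 := by norm_num
  exact h.trans e

end Summit.MatrixMultiplication.OmegaCensus

end
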